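import Summits.ResolutionOfSingularities.ResolutionOfSingularities.Theorems.EquisingularLiftEquisingularLiftNatDepthTower
import HarnessLib

/-!
# [OURS] ONE MODEL SUFFICES: a level is certified by ANY ONE blow-up at the point (uniqueness of blow-ups) — the working form of every concrete certificate
# (cruxes `Theses.EquisingularLift.EquisingularLiftNat` / `…NatThree`, stmt-ResolutionOfSingularities-20038 / -20148)

[OURS · leafhand-res-equisingularlift-10 g1, 2026-08-31; cell `pub/decomp-res`] AI-produced, weaker than expert review; NOT a statement of any manuscript;
nothing here proves resolution of singularities in positive characteristic.  DEF-FREE helper; no `sorry`; standard axioms; ZERO named hypotheses.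

The tower levels (`hD0` / `hDsucc`) are phrased intrinsically — «EVERY blow-up of `Γ` at the reduced closed point `y` …».  A chart computation produces ONE
blow-up (the `Proj` of the Rees algebra, or glued charts).  Blow-ups along the same ideal sheaf are unique up to a unique isomorphism over the base
(tree ✓ `IsBlowup.unique`, Görtz–Wedhorn (13.19)), and the step datum moves across an isomorphism over `Γ`; so ONE MODEL SUFFICES:

* ★★★ `PointChain.stepAt_of_model` — for a local payload `E`: ONE blow-up `τ₀ : Z₀ → Γ` at `y`, regular over `y` off a finite set `S₀` of closed `E`-points over
  `y` ⟹ the same for EVERY blow-up at `y` (transport along `Z₀ ≅ Z` over `Γ`);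
* ★★ `towerLevel_zero_of_model` — one blow-up at `y` regular over `y` ⟹ level `0` in every blow-up tower;
* ★★★ `towerLevel_succ_of_model` — **one blow-up at `y` regular over `y` off finitely many closed points of levels `≤ d` ⟹ level `d + 1`** in every blow-up
  tower `D` (payload locality from ✓ `tower_loc`).

This is the interface the per-class certificates (`A₃ / A₄ / D₄` at level `1`, …) will use: exhibit the chart model, list the exceptional singular points, cite
their (lower) levels.  Honest label: closes no registered stub.

References: [GortzWedhorn2020, (13.19), Prop. 13.91]; [StacksProject, Tags 080E, 02OS]; [Hartshorne1977, II 7.14–7.16] — through the cited tree files.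
-/

set_option linter.dupNamespace false -- mandated namespace `Summit.<Summit>.<Problem>` of this single-conjunct summit

noncomputable section

open CategoryTheory CategoryTheory.Limits AlgebraicGeometry TopologicalSpace
open Literature.AlgebraicGeometry.Resolution Literature.AlgebraicGeometry.Motives
open AlgebraicGeometry.Scheme.IdealSheafData

namespace Summit.ResolutionOfSingularities.ResolutionOfSingularities.Cruxes.EquisingularLiftNat.Sections

namespace PointChain

universe u

/-- ★★★ **ONE MODEL SUFFICES.**  `E` a point-property local in `iff` form (`hE`); `y` a closed point of `Γ`; ONE blow-up `τ₀ : Z₀ → Γ` of `Γ` at the reduced point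
`y` which is regular over `y` off a finite set `S₀` of closed `E`-points over `y`.  Then EVERY blow-up `τ : Z → Γ` at `y` is regular over `y` off a finite set of
closed `E`-points over `y`: blow-ups are unique up to isomorphism over `Γ` (✓ `IsBlowup.unique`), and the datum moves along `Z₀ ≅ Z` (stalks, closedness, and the
payload by `hE` for the isomorphism). [OURS] [cite: GortzWedhorn2020, (13.19)] -/
theorem stepAt_of_model (E : ∀ Z : Scheme.{u}, Z → Prop)
    (hE : ∀ (Z Z₂ : Scheme.{u}) (ρ : Z₂ ⟶ Z) (U : Z.Opens), IsIso (ρ ∣_ U) → ∀ z : Z, z ∈ U → IsClosed (({z} : Set Z)) →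
      ∀ z₂ : Z₂, ρ z₂ = z → IsClosed (({z₂} : Set Z₂)) → (E Z z ↔ E Z₂ z₂))
    {Γ : Scheme.{u}} {y : Γ} (hy : IsClosed (({y} : Set Γ))) (Z₀ : Scheme.{u}) (τ₀ : Z₀ ⟶ Γ) (hτ₀ : IsBlowup τ₀ (vanishingIdeal ⟨{y}, hy⟩))
    (S₀ : Finset Z₀) (hreg₀ : ∀ z : Z₀, τ₀ z = y → z ∉ S₀ → IsRegularLocalRing (Z₀.presheaf.stalk z))
    (hS₀ : ∀ z ∈ S₀, τ₀ z = y ∧ IsClosed (({z} : Set Z₀)) ∧ E Z₀ z) :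
    ∀ (hy' : IsClosed (({y} : Set Γ))) (Z : Scheme.{u}) (τ : Z ⟶ Γ), IsBlowup τ (vanishingIdeal ⟨{y}, hy'⟩) →
      ∃ S' : Finset Z, (∀ z : Z, τ z = y → z ∉ S' → IsRegularLocalRing (Z.presheaf.stalk z)) ∧
        ∀ z ∈ S', τ z = y ∧ IsClosed (({z} : Set Z)) ∧ E Z z := by
  classical
  intro hy' Z τ hτ
  obtain ⟨e, he, he'⟩ := hτ₀.unique hτ
  have hinv : ∀ z₀ : Z₀, e.inv (e.hom z₀) = z₀ := fun z₀ => by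
    rw [← Scheme.Hom.comp_apply, e.hom_inv_id]; rfl
  have hhom : ∀ z : Z, e.hom (e.inv z) = z := fun z => by
    rw [← Scheme.Hom.comp_apply, e.inv_hom_id]; rfl
  haveI : IsIso (e.inv ∣_ (⊤ : Z₀.Opens)) := inferInstance
  refine ⟨S₀.image e.hom, fun z hz hzS => ?_, fun z hz => ?_⟩
  · -- regular off the transported set
    have hz₀ : τ₀ (e.inv z) = y := by rw [← Scheme.Hom.comp_apply, he']; exact hz
    have hzS₀ : e.inv z ∉ S₀ := fun h => hzS (Finset.mem_image.mpr ⟨e.inv z, h, hhom z⟩)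
    haveI := hreg₀ (e.inv z) hz₀ hzS₀
    exact IsRegularLocalRing.of_ringEquiv (R := Z₀.presheaf.stalk (e.inv z)) (asIso (e.inv.stalkMap z)).commRingCatIsoToRingEquiv
  · -- the transported points: over `y`, closed, `E`-points
    obtain ⟨z₀, hz₀S, rfl⟩ := Finset.mem_image.mp hz
    obtain ⟨hτz₀, hz₀cl, hEz₀⟩ := hS₀ z₀ hz₀S
    have hτz : τ (e.hom z₀) = y := by rw [← Scheme.Hom.comp_apply, he]; exact hτz₀
    have hzcl : IsClosed (({e.hom z₀} : Set Z)) :=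
      isClosed_singleton_of_injective e.inv (Scheme.homeoOfIso e.symm).injective (by rw [hinv]; exact hz₀cl)
    exact ⟨hτz, hzcl, (hE Z₀ Z e.inv ⊤ inferInstance z₀ (Set.mem_univ z₀) hz₀cl (e.hom z₀) (hinv z₀) hzcl).mp hEz₀⟩

end PointChain

/-- ★★ **LEVEL `0` FROM ONE MODEL**: a closed point `y` of `Γ` and ONE blow-up `τ₀ : Z₀ → Γ` at `y` that is regular over `y` ⟹ `D 0 Γ y` for every blow-up tower
`D` (✓ `PointChain.stepAt_of_model` with the empty payload). [OURS] [cite: GortzWedhorn2020, (13.19)] -/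
theorem towerLevel_zero_of_model (D : ℕ → ∀ Γ : Scheme.{0}, Γ → Prop)
    (hD0 : ∀ (Γ : Scheme.{0}) (y : Γ), IsClosed (({y} : Set Γ)) →
      (D 0 Γ y ↔ ∀ (hy : IsClosed (({y} : Set Γ))) (Z : Scheme.{0}) (τ : Z ⟶ Γ), IsBlowup τ (vanishingIdeal ⟨{y}, hy⟩) →
        ∀ z : Z, τ z = y → IsRegularLocalRing (Z.presheaf.stalk z)))
    {Γ : Scheme.{0}} {y : Γ} (hy : IsClosed (({y} : Set Γ))) (Z₀ : Scheme.{0}) (τ₀ : Z₀ ⟶ Γ) (hτ₀ : IsBlowup τ₀ (vanishingIdeal ⟨{y}, hy⟩))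
    (hreg₀ : ∀ z : Z₀, τ₀ z = y → IsRegularLocalRing (Z₀.presheaf.stalk z)) : D 0 Γ y := by
  classical
  refine (hD0 Γ y hy).mpr fun hy' Z τ hτ z hz => ?_
  obtain ⟨S', hreg, hS'⟩ := PointChain.stepAt_of_model (fun (_ : Scheme.{0}) _ => False) (fun _ _ _ _ _ _ _ _ _ _ _ => Iff.rfl) hy Z₀ τ₀ hτ₀ ∅
    (fun z hz _ => hreg₀ z hz) (fun z hz => absurd hz (Finset.notMem_empty z)) hy' Z τ hτ
  by_cases hzS : z ∈ S'
  · exact absurd (hS' z hzS).2.2 id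
  · exact hreg z hz hzS

/-- ★★★ **LEVEL `d + 1` FROM ONE MODEL**: a closed point `y` of `Γ` and ONE blow-up `τ₀ : Z₀ → Γ` at `y`, regular over `y` off a finite set `S₀` of closed points
over `y` of `D`-levels `≤ d` ⟹ `D (d + 1) Γ y`, for every blow-up tower `D` (✓ `PointChain.stepAt_of_model`; the payload «some level `≤ d`» is local by
✓ `tower_loc`). [OURS] [cite: GortzWedhorn2020, (13.19)] [cite: StacksProject, Tag 080E] -/
theorem towerLevel_succ_of_model (D : ℕ → ∀ Γ : Scheme.{0}, Γ → Prop)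
    (hD0 : ∀ (Γ : Scheme.{0}) (y : Γ), IsClosed (({y} : Set Γ)) →
      (D 0 Γ y ↔ ∀ (hy : IsClosed (({y} : Set Γ))) (Z : Scheme.{0}) (τ : Z ⟶ Γ), IsBlowup τ (vanishingIdeal ⟨{y}, hy⟩) →
        ∀ z : Z, τ z = y → IsRegularLocalRing (Z.presheaf.stalk z)))
    (hDsucc : ∀ (d : ℕ) (Γ : Scheme.{0}) (y : Γ), IsClosed (({y} : Set Γ)) →
      (D (d + 1) Γ y ↔ ∀ (hy : IsClosed (({y} : Set Γ))) (Z : Scheme.{0}) (τ : Z ⟶ Γ), IsBlowup τ (vanishingIdeal ⟨{y}, hy⟩) →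
        ∃ S' : Finset Z, (∀ z : Z, τ z = y → z ∉ S' → IsRegularLocalRing (Z.presheaf.stalk z)) ∧
          ∀ z ∈ S', τ z = y ∧ IsClosed (({z} : Set Z)) ∧ ∃ d' ≤ d, D d' Z z))
    (d : ℕ) {Γ : Scheme.{0}} {y : Γ} (hy : IsClosed (({y} : Set Γ))) (Z₀ : Scheme.{0}) (τ₀ : Z₀ ⟶ Γ)
    (hτ₀ : IsBlowup τ₀ (vanishingIdeal ⟨{y}, hy⟩)) (S₀ : Finset Z₀)
    (hreg₀ : ∀ z : Z₀, τ₀ z = y → z ∉ S₀ → IsRegularLocalRing (Z₀.presheaf.stalk z))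
    (hS₀ : ∀ z ∈ S₀, τ₀ z = y ∧ IsClosed (({z} : Set Z₀)) ∧ ∃ d' ≤ d, D d' Z₀ z) : D (d + 1) Γ y := by
  have hE : ∀ (Z Z₂ : Scheme.{0}) (ρ : Z₂ ⟶ Z) (U : Z.Opens), IsIso (ρ ∣_ U) → ∀ z : Z, z ∈ U → IsClosed (({z} : Set Z)) →
      ∀ z₂ : Z₂, ρ z₂ = z → IsClosed (({z₂} : Set Z₂)) → ((∃ d' ≤ d, D d' Z z) ↔ ∃ d' ≤ d, D d' Z₂ z₂) := by
    intro Z Z₂ ρ U hρ z hzU hz z₂ hz₂ hz₂cl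
    exact exists_congr fun d' => and_congr_right fun _ => tower_loc D hD0 hDsucc d' Z Z₂ ρ U hρ z hzU hz z₂ hz₂ hz₂cl
  exact (hDsucc d Γ y hy).mpr (PointChain.stepAt_of_model (fun Z z => ∃ d' ≤ d, D d' Z z) hE hy Z₀ τ₀ hτ₀ S₀ hreg₀ hS₀)

end Summit.ResolutionOfSingularities.ResolutionOfSingularities.Cruxes.EquisingularLiftNat.Sections

end
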